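import Literature.Geometry.Lorentzian.SpacetimeLocalConvergenceTimeOrientation
import HarnessLib

/-!
# Limits of limits for FAMILIES, I: levels, reference balls and indices of the general diagonal datum
(topic `Geometry/Lorentzian`; the selections behind `LocalSubconvergence.diag` of
`SpacetimeLocalConvergenceDiag.lean` — the stage-dependent generalisation of
`SpacetimeLocalConvergenceTransIndex.lean`; Petersen 2006, Ch. 10, §3.2; Hale 1980, Ch. I §8,
Thm. 8.1: limit sets are CLOSED)

Given a subconvergence datum `E : (𝓤ᵢ, uᵢ) ⇀ (𝓥, v)` of a SEQUENCE of pointed spacetimes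
(comparison maps `Fⱼ : 𝓥 → 𝓤_{sub j}`) and, for every `i`, a subconvergence datum
`D i : (𝓢ᵢₙ, pᵢₙ)ₙ ⇀ (𝓤ᵢ, uᵢ)` (comparison maps `φᵢₙ`), this file makes the selections of the diagonal
datum `(𝓢_{i(m), n(m)}, Q m) ⇀ (𝓥, v)`:

* `diagLevel` (`exists_diagLevel`): a strictly increasing reindexing of the exhaustion of `E` with
  `closure (U (level m)) ⊆ U (level (m+1))` and `dF_{level (m+1)}(T_𝓥)` TIMELIKE on
  `closure (U (level m))`.
* `diagRefPoints`, `diagRefRadius`, `diagRefBall` (`exists_diagRefData`): finitely many compact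
  reference chart balls of `𝓥` per level inside `U (level (m+1))` whose open cores cover
  `closure (U (level m))`.
* `diagStage m = sub (level (m+1))` (the family member used at stage `m`),
  `diagStageMap m = F_{level (m+1)}`, `diagStageSet m = closure (U (level m))`, the first bracket
  `(φ_{i,n} ∘ F ∘ c_p⁻¹)^* g_{i,n} − (F ∘ c_p⁻¹)^* g_{𝓤ᵢ}` (`i = diagStage m`), the requirements
  `DiagIndexGood m n` in the datum `D (diagStage m)` and the strictly increasing `diagIndex`.

The case of a constant family `𝓤ᵢ = 𝓣`, `D i = D₁` is `SpacetimeLocalConvergenceTransIndex.lean`.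

## References
* [Petersen2006] P. Petersen, *Riemannian Geometry*, 2nd ed., GTM 171, Springer 2006, Ch. 10, §3.2.
* [Hale1980] J. K. Hale, *Ordinary Differential Equations*, 2nd ed., Krieger 1980, Ch. I §8, Thm. 8.1.
-/

noncomputable section

open TopologicalSpace Manifold Filter Topology Set Function Metric Bundle
open scoped ContDiff Topology ENNReal

universe u v w

namespace Literature.Geometry.Lorentzian

namespace Spacetime

namespace LocalSubconvergence

variable {𝓤ᵢ : ℕ → Spacetime.{v} 4} {uᵢ : ∀ i, (𝓤ᵢ i).carrier} {𝓥 : Spacetime.{w} 4}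
  {v₀ : 𝓥.carrier} {k : ℕ} {𝓢ᵢₙ : ℕ → ℕ → Spacetime.{u} 4} {pᵢₙ : ∀ i n, (𝓢ᵢₙ i n).carrier}

/-! ### Step A: the levels -/

section Level

variable (E : LocalSubconvergence 𝓤ᵢ uᵢ 𝓥 v₀ k)

/-- **Existence of the levels**: a strictly increasing `ρ` with
`closure (U (ρ m)) ⊆ U (ρ (m+1))` and `dF_{ρ (m+1)}(T_𝓥 x)` timelike for `x ∈ closure (U (ρ m))`.
[cite: Petersen2006, Ch. 10 §3.2] -/
theorem exists_diagLevel : ∃ ρ : ℕ → ℕ, StrictMono ρ ∧ ∀ m,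
    closure (E.U (ρ m) : Set 𝓥.carrier) ⊆ E.U (ρ (m + 1)) ∧
      ∀ x ∈ closure (E.U (ρ m) : Set 𝓥.carrier), (𝓤ᵢ (E.sub (ρ (m + 1)))).metric.IsTimelike
        (mfderiv (𝓡 4) (𝓡 4) (E.embed (ρ (m + 1))) x (𝓥.timeOrientation.vectorField x)) := by
  have h : ∀ i, ∀ᶠ j in atTop, closure (E.U i : Set 𝓥.carrier) ⊆ E.U j ∧
      ∀ x ∈ closure (E.U i : Set 𝓥.carrier), (𝓤ᵢ (E.sub j)).metric.IsTimelike
        (mfderiv (𝓡 4) (𝓡 4) (E.embed j) x (𝓥.timeOrientation.vectorField x)) := fun i ↦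
    (E.eventually_subset_U (E.isCompact_closure_U i)).and
      (E.eventually_isTimelike_mfderiv_embed (E.isCompact_closure_U i))
  obtain ⟨ρ, hρ, -, hstep⟩ := exists_strictMono_step h 0
  exact ⟨ρ, hρ, hstep⟩

/-- The **levels** of the general diagonal datum (a choice in `exists_diagLevel`). [folklore] -/
def diagLevel : ℕ → ℕ := Classical.choose E.exists_diagLevel

/-- The levels are strictly increasing. [folklore] -/
theorem strictMono_diagLevel : StrictMono E.diagLevel :=
  (Classical.choose_spec E.exists_diagLevel).1

/-- `closure (U (level m)) ⊆ U (level (m + 1))`. [folklore] -/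
theorem closure_U_diagLevel_subset (m : ℕ) :
    closure (E.U (E.diagLevel m) : Set 𝓥.carrier) ⊆ E.U (E.diagLevel (m + 1)) :=
  ((Classical.choose_spec E.exists_diagLevel).2 m).1

/-- `dF_{level (m+1)}(T_𝓥 x)` is timelike for `x ∈ closure (U (level m))`. [folklore] -/
theorem isTimelike_mfderiv_embed_diagLevel (m : ℕ) {x : 𝓥.carrier}
    (hx : x ∈ closure (E.U (E.diagLevel m) : Set 𝓥.carrier)) :
    (𝓤ᵢ (E.sub (E.diagLevel (m + 1)))).metric.IsTimelike
      (mfderiv (𝓡 4) (𝓡 4) (E.embed (E.diagLevel (m + 1))) x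
        (𝓥.timeOrientation.vectorField x)) :=
  ((Classical.choose_spec E.exists_diagLevel).2 m).2 x hx

/-- Monotonicity of the level sets. [folklore] -/
theorem U_diagLevel_mono {m m' : ℕ} (h : m ≤ m') : E.U (E.diagLevel m) ≤ E.U (E.diagLevel m') :=
  E.monotone_U (E.strictMono_diagLevel.monotone h)

/-- `U (level m) ⊆ U (level (m + 1))` through the closure. [folklore] -/
theorem U_diagLevel_subset_succ (m : ℕ) :
    (E.U (E.diagLevel m) : Set 𝓥.carrier) ⊆ E.U (E.diagLevel (m + 1)) :=
  subset_closure.trans (E.closure_U_diagLevel_subset m)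

/-! ### Step B: reference balls -/

/-- **Reference balls of level `m`**: finitely many chart balls of `𝓥`, compact closed versions in
the chart targets and pulled back inside `U (level (m+1))`, whose open cores cover
`closure (U (level m))`. [folklore] -/
theorem exists_diagRefData (m : ℕ) : ∃ (S : Finset 𝓥.carrier) (r : 𝓥.carrier → ℝ),
    (∀ p ∈ S, 0 < r p ∧ closedBall (chartAt E4 p p) (r p) ⊆ (chartAt E4 p).target ∧
      (chartAt E4 p).symm '' closedBall (chartAt E4 p p) (r p) ⊆ E.U (E.diagLevel (m + 1))) ∧
    closure (E.U (E.diagLevel m) : Set 𝓥.carrier) ⊆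
      ⋃ p ∈ S, (chartAt E4 p).source ∩ chartAt E4 p ⁻¹' ball (chartAt E4 p p) (r p) :=
  𝓥.exists_finset_chartBalls (E.U _).isOpen (E.isCompact_closure_U _)
    (E.closure_U_diagLevel_subset m)

/-- The reference points of level `m`. [folklore] -/
def diagRefPoints (m : ℕ) : Finset 𝓥.carrier := Classical.choose (E.exists_diagRefData m)

/-- The reference radii of level `m`. [folklore] -/
def diagRefRadius (m : ℕ) : 𝓥.carrier → ℝ :=
  Classical.choose (Classical.choose_spec (E.exists_diagRefData m))

/-- The closed reference ball of the reference point `p` of level `m`. [folklore] -/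
def diagRefBall (m : ℕ) (p : 𝓥.carrier) : Set E4 :=
  closedBall (chartAt E4 p p) (E.diagRefRadius m p)

/-- Properties of the reference balls. [folklore] -/
theorem diagRefBall_spec {m : ℕ} {p : 𝓥.carrier} (hp : p ∈ E.diagRefPoints m) :
    0 < E.diagRefRadius m p ∧ E.diagRefBall m p ⊆ (chartAt E4 p).target ∧
      (chartAt E4 p).symm '' E.diagRefBall m p ⊆ E.U (E.diagLevel (m + 1)) :=
  (Classical.choose_spec (Classical.choose_spec (E.exists_diagRefData m))).1 p hp

/-- The open cores of the reference balls of level `m` cover `closure (U (level m))`. [folklore] -/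
theorem closure_U_diagLevel_subset_refCover (m : ℕ) :
    closure (E.U (E.diagLevel m) : Set 𝓥.carrier) ⊆ ⋃ p ∈ E.diagRefPoints m,
      (chartAt E4 p).source ∩ chartAt E4 p ⁻¹' ball (chartAt E4 p p) (E.diagRefRadius m p) :=
  (Classical.choose_spec (Classical.choose_spec (E.exists_diagRefData m))).2

/-- The reference balls are compact. [folklore] -/
theorem isCompact_diagRefBall (m : ℕ) (p : 𝓥.carrier) : IsCompact (E.diagRefBall m p) :=
  isCompact_closedBall _ _

/-- The **family member used at stage `m`**: `i(m) = sub (level (m+1))`. [folklore] -/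
abbrev diagStage (m : ℕ) : ℕ := E.sub (E.diagLevel (m + 1))

/-- The stages are strictly increasing. [folklore] -/
theorem strictMono_diagStage : StrictMono E.diagStage :=
  E.strictMono_sub.comp (E.strictMono_diagLevel.comp (strictMono_id.add_const 1))

/-- The intermediate map of stage `m`: `F_m = F_{level (m+1)} : 𝓥 → 𝓤_{i(m)}`. [folklore] -/
def diagStageMap (m : ℕ) : 𝓥.carrier → (𝓤ᵢ (E.diagStage m)).carrier :=
  E.embed (E.diagLevel (m + 1))

/-- The compact set of stage `m`: `C_m = closure (U (level m))`. [folklore] -/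
def diagStageSet (m : ℕ) : Set 𝓥.carrier := closure (E.U (E.diagLevel m) : Set 𝓥.carrier)

/-- The stage sets are compact. [folklore] -/
theorem isCompact_diagStageSet (m : ℕ) : IsCompact (E.diagStageSet m) := E.isCompact_closure_U _

/-- The stage map is `C^∞` on `U (level (m+1)) ⊇ C_m`. [folklore] -/
theorem contMDiffOn_diagStageMap (m : ℕ) :
    ContMDiffOn (𝓡 4) (𝓡 4) ∞ (E.diagStageMap m) (E.U (E.diagLevel (m + 1))) :=
  E.contMDiffOn_embed _

/-- The stage map sends the base point to the base point of the family member. [folklore] -/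
theorem diagStageMap_basepoint (m : ℕ) : E.diagStageMap m v₀ = uᵢ (E.diagStage m) :=
  E.embed_basepoint _

end Level

/-! ### Step C: the indices -/

section Index

variable (D : ∀ i, LocalSubconvergence (𝓢ᵢₙ i) (pᵢₙ i) (𝓤ᵢ i) (uᵢ i) k)
  (E : LocalSubconvergence 𝓤ᵢ uᵢ 𝓥 v₀ k)

/-- The **first bracket** of stage `m` at index `n` in the chart of `𝓥` at `p`:
`(φ_{i,n} ∘ F_m ∘ c_p⁻¹)^* g_{i,n} − (F_m ∘ c_p⁻¹)^* g_{𝓤ᵢ}`, `i = diagStage m`. [folklore] -/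
def diagFirstBracket (n m : ℕ) (p : 𝓥.carrier) : E4 → E4 →L[ℝ] E4 →L[ℝ] ℝ :=
  (𝓢ᵢₙ (E.diagStage m) ((D (E.diagStage m)).sub n)).metricInCoords
      (((D (E.diagStage m)).embed n ∘ E.diagStageMap m) ∘ (chartAt E4 p).symm) -
    (𝓤ᵢ (E.diagStage m)).metricInCoords (E.diagStageMap m ∘ (chartAt E4 p).symm)

/-- The three requirements on the index of stage `m` (in the datum `D (diagStage m)`). [folklore] -/
def DiagIndexGood (m n : ℕ) : Prop :=
  E.diagStageMap m '' E.diagStageSet m ⊆ (D (E.diagStage m)).U n ∧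
    (∀ x ∈ E.diagStageSet m,
      (𝓢ᵢₙ (E.diagStage m) ((D (E.diagStage m)).sub n)).timeOrientation.IsFutureDirected
        (mfderiv (𝓡 4) (𝓡 4) ((D (E.diagStage m)).embed n ∘ E.diagStageMap m) x
          (𝓥.timeOrientation.vectorField x))) ∧
    ∀ m₀ ∈ Finset.range (m + 1), ∀ p ∈ E.diagRefPoints m₀,
      supCkENorm (E.diagRefBall m₀ p) k (diagFirstBracket D E n m p) ≤ ((m + 1 : ℕ) : ℝ≥0∞)⁻¹

/-- **Each requirement holds for all large indices.** [cite: Petersen2006, Ch. 10 §3.2] -/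
theorem eventually_diagIndexGood (m : ℕ) : ∀ᶠ n in atTop, DiagIndexGood D E m n := by
  have hCO : E.diagStageSet m ⊆ E.U (E.diagLevel (m + 1)) := E.closure_U_diagLevel_subset m
  have hFc : ContinuousOn (E.diagStageMap m) (E.U (E.diagLevel (m + 1))) :=
    (E.contMDiffOn_diagStageMap m).continuousOn
  -- (i)
  have h1 : ∀ᶠ n in atTop, E.diagStageMap m '' E.diagStageSet m ⊆ (D (E.diagStage m)).U n :=
    (D _).eventually_subset_U ((E.isCompact_diagStageSet m).image_of_continuousOn (hFc.mono hCO))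
  -- (ii)
  have h2 : ∀ᶠ n in atTop, ∀ x ∈ E.diagStageSet m,
      (𝓢ᵢₙ (E.diagStage m) ((D (E.diagStage m)).sub n)).timeOrientation.IsFutureDirected
        (mfderiv (𝓡 4) (𝓡 4) ((D (E.diagStage m)).embed n ∘ E.diagStageMap m) x
          (𝓥.timeOrientation.vectorField x)) :=
    (D _).eventually_isFutureDirected_mfderiv_comp (E.U _).isOpen (E.contMDiffOn_diagStageMap m)
      (E.isCompact_diagStageSet m) hCO
      (fun x hx ↦ E.isFutureDirected_mfderiv_embed _ x (hCO hx))
      (fun x hx ↦ E.isTimelike_mfderiv_embed_diagLevel m hx)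
  -- (iii)
  have h3 : ∀ᶠ n in atTop, ∀ m₀ ∈ Finset.range (m + 1), ∀ p ∈ E.diagRefPoints m₀,
      supCkENorm (E.diagRefBall m₀ p) k (diagFirstBracket D E n m p) ≤
        ((m + 1 : ℕ) : ℝ≥0∞)⁻¹ := by
    refine (eventually_all_finset _).2 fun m₀ hm₀ ↦ (eventually_all_finset _).2 fun p hp ↦ ?_
    have hm₀' : m₀ + 1 ≤ m + 1 := Nat.succ_le_succ (Nat.lt_succ_iff.1 (Finset.mem_range.1 hm₀))
    obtain ⟨-, hBt, hBU⟩ := E.diagRefBall_spec hp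
    have hKW : MapsTo (chartAt E4 p).symm (E.diagRefBall m₀ p) (E.U (E.diagLevel (m + 1))) :=
      fun y hy ↦ E.U_diagLevel_mono hm₀' (hBU (mem_image_of_mem _ hy))
    have hlim := (D (E.diagStage m)).tendsto_supCkENorm_comp_sub (E.U _).isOpen
      (E.contMDiffOn_diagStageMap m) p (E.isCompact_diagRefBall m₀ p) hBt hKW
    have hpos : (0 : ℝ≥0∞) < ((m + 1 : ℕ) : ℝ≥0∞)⁻¹ :=
      ENNReal.inv_pos.2 (ENNReal.natCast_ne_top _)
    filter_upwards [(tendsto_order.1 hlim).2 _ hpos] with n hn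
    exact hn.le
  filter_upwards [h1, h2, h3] with n hn1 hn2 hn3
  exact ⟨hn1, hn2, hn3⟩

/-- **Existence of the indices**: a strictly increasing `ι` with `DiagIndexGood m (ι m)` for all
`m`. [folklore] -/
theorem exists_diagIndex : ∃ ι : ℕ → ℕ, StrictMono ι ∧ ∀ m, DiagIndexGood D E m (ι m) :=
  extraction_forall_of_eventually fun m ↦ eventually_diagIndexGood D E m

/-- The **indices** of the general diagonal datum (a choice in `exists_diagIndex`). [folklore] -/
def diagIndex : ℕ → ℕ := Classical.choose (exists_diagIndex D E)

/-- The indices are strictly increasing. [folklore] -/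
theorem strictMono_diagIndex : StrictMono (diagIndex D E) :=
  (Classical.choose_spec (exists_diagIndex D E)).1

/-- The indices are good. [folklore] -/
theorem diagIndexGood_diagIndex (m : ℕ) : DiagIndexGood D E m (diagIndex D E m) :=
  (Classical.choose_spec (exists_diagIndex D E)).2 m

end Index

end LocalSubconvergence

end Spacetime

end Literature.Geometry.Lorentzian
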